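import Summits.BirchSwinnertonDyer.Rank1Residual.X11b.CastellaErratumChain
import Literature.NumberTheory.EllipticCurves.QuadraticTwistPadicReduction
import Literature.NumberTheory.EllipticCurves.QuadraticTwistJInvariantProofs
import Literature.NumberTheory.EllipticCurves.PAdicHeightsTateValuationProofs
import Literature.NumberTheory.EllipticCurves.Rank1Residual.GVParityTwistProofs
import Literature.NumberTheory.EllipticCurves.VariableChangePointsMap
import Literature.NumberTheory.DiophantineGeometry.LocalReductionProofs
import Literature.NumberTheory.QuadraticForms.PadicHilbertSymbol
import Literature.NumberTheory.QuadraticFields.KroneckerSplitting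
import HarnessLib

/-!
# X11b, route R1 — the twist-transport link PROVED (quadratic twists at split primes)

HONEST FRAMING (cell `b2b-bsdres`, verbatim): the goal of the cell is to DELETE the
COMBINATION-SHAPED residual classes for ALL analytic-rank `≤ 1` curves over `ℚ` — "full BSD
formula for every rank `≤ 1` curve in class C" assembled STRICTLY from published theorems — so that
the rank-`≤ 1` remainder becomes exactly the CONSTRUCTION-SHAPED classes, which are TYPED
(missing-input `Prop`s), NOT attempted. This is not "finishing BSD". Sub-cell `b2b-bsdres-multr1-p1`,
research route R1 for X11b (Castella 2018 Thm. A re-proved along the author's erratum). This file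
removes one of the six link hypotheses of `routeGoal_of_links` (`CastellaErratumChain.lean`) by
PROVING it: the elementary transport of the hypotheses of Skinner 2016 Thm. C from `E` to a globally
minimal model `Wd` of the twist `E^{(d_K)}` along primes split in `K` (hypothesis `hT`,
`TwistTransportAt`). No named fact, no `def`, nothing asserted; everything from tree theorems.

* `isSquare_padic_discr_of_splitsIn` — if `ℓ` splits in the quadratic field `K` then `d_K` is a
  square in `ℚ_ℓ` (decomposition law `QuadraticFields.Quadratic.ncard_primesOver_eq_two_iff_jacobiSym`
  / `…_two_eq_two_iff` + Hensel: `QuadraticForms.padic_isSquare_intCast_of_isSquare_zmod`,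
  `…_of_mod_eight`; Serre, *Cours d'arithmétique* II.3.3).
* `exists_baseChange_eq_smul_of_twist` — for `d` a square in `ℚ_ℓ` and `C • W^{(d)} = Wd`,
  `Wd ⊗ ℚ_ℓ = D • (W ⊗ ℚ_ℓ)` (Silverman AEC X.5 Cor. 5.4: the twist by a square is isomorphic).
* `mult_iff_of_twist` — multiplicative reduction at `ℓ` transports (AEC VII.5 Prop. 5.1(b) with
  VII.1 Prop. 1.3(b): `hasMultiplicativeReduction_iff_of_isMinimal_of_eq_smul`).
* `padicValInt_minimalDiscriminantInt_eq_of_twist` — `v_ℓ(Δ_min(Wd)) = v_ℓ(Δ_min(W))` (both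
  globally minimal models are `ℤ_ℓ`-minimal, `isMinimal_baseChange_padic_of_isGloballyMinimal`, and
  `ℚ_ℓ`-isomorphic minimal equations have the same `v(Δ)`, `padicMulValuation_Δ_smul_eq_of_isMinimal`).
* `irr_of_twist` — `E[p]` irreducible ⇒ `E^{(d)}[p]` irreducible (the twist of the twist is `E`:
  `quadraticTwist_smul`, `quadraticTwist_quadraticTwist`, and x1's `not_hasIrreducibleModPGaloisRep_twist`).
* `twistTransportAt_of_twist` — the link `TwistTransportAt W p K Wd` for every imaginary quadratic
  `K` and globally minimal model `Wd` of `E^{(d_K)}`.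
* `routeGoal_of_links'` — `routeGoal_of_links` with `hT` discharged: `RouteGoal` from the three
  published named facts, the proved tree theorems, and FIVE links (`hField`, `hHeeg`, `hA` (OPEN),
  `hB`, `hC`).
-/

noncomputable section

open scoped Classical

open WeierstrassCurve NumberField Literature.NumberTheory.EllipticCurves
  Literature.NumberTheory.EllipticCurves.Rank1Residual
  Literature.NumberTheory.EllipticCurves.Rank1Residual.Typed

namespace Summit.BirchSwinnertonDyer.Rank1Residual.X11b

section Twist

variable {K : Type} [Field K] [NumberField K]

/-- **A prime split in a quadratic field makes the discriminant a local square**: if `ℓ` splits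
in `K` (`[K:ℚ] = 2`) then `d_K ∈ (ℚ_ℓ^×)²` — for odd `ℓ`, `(d_K/ℓ) = 1` (decomposition law) and
Hensel; for `ℓ = 2`, `d_K ≡ 1 (mod 8)`. [folklore] -/
theorem isSquare_padic_discr_of_splitsIn (h2 : Module.finrank ℚ K = 2) {ℓ : ℕ} [Fact ℓ.Prime]
    (hs : SplitsIn K ℓ) : IsSquare ((NumberField.discr K : ℚ) : ℚ_[ℓ]) := by
  have hℓ : ℓ.Prime := Fact.out
  have hcast : ((NumberField.discr K : ℚ) : ℚ_[ℓ]) = ((NumberField.discr K : ℤ) : ℚ_[ℓ]) := by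
    push_cast; rfl
  rw [hcast]
  by_cases hℓ2 : ℓ = 2
  · subst hℓ2
    have h8 : NumberField.discr K % 8 = 1 :=
      (Literature.NumberTheory.QuadraticFields.Quadratic.ncard_primesOver_two_eq_two_iff h2).mp hs
    exact Literature.NumberTheory.QuadraticForms.padic_isSquare_intCast_of_mod_eight rfl h8
  · have hJ : jacobiSym (NumberField.discr K) ℓ = 1 :=
      (Literature.NumberTheory.QuadraticFields.Quadratic.ncard_primesOver_eq_two_iff_jacobiSym h2 hℓ
        hℓ2).mp hs
    -- `(d_K/ℓ) = 1`: `ℓ ∤ d_K` and `d_K` is a square mod `ℓ`, so a square in `ℚ_ℓ` (Hensel)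
    have hnd : ¬ (ℓ : ℤ) ∣ NumberField.discr K := fun hdvd ↦ by
      have h0 : jacobiSym (NumberField.discr K) ℓ = 0 := by
        rw [jacobiSym.mod_left, Int.emod_eq_zero_of_dvd hdvd, jacobiSym.zero_left hℓ.one_lt]
      rw [h0] at hJ
      exact zero_ne_one hJ
    exact Literature.NumberTheory.QuadraticForms.padic_isSquare_intCast_of_isSquare_zmod hℓ2 hnd
      (ZMod.isSquare_of_jacobiSym_eq_one hJ)

variable (W : WeierstrassCurve ℚ) [W.IsElliptic]

omit [W.IsElliptic] in
/-- **Twisting by an `ℓ`-adic square does not change the curve over `ℚ_ℓ`**: if `d` is a square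
in `ℚ_ℓ` and `C • W^{(d)} = Wd`, then `Wd ⊗ ℚ_ℓ = D • (W ⊗ ℚ_ℓ)` for an explicit change of
variables `D` (Silverman, *AEC* X.5 Cor. 5.4; `exists_variableChange_smul_eq_quadraticTwist_sq`,
`map_quadraticTwist`, `VariableChange.baseChange_smul_eq`). [folklore] -/
theorem exists_baseChange_eq_smul_of_twist {d : ℚ} (hd : d ≠ 0) {ℓ : ℕ} [Fact ℓ.Prime]
    (hsq : IsSquare ((d : ℚ) : ℚ_[ℓ])) (Wd : WeierstrassCurve ℚ) {C : VariableChange ℚ}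
    (hC : C • W.quadraticTwist d = Wd) :
    ∃ D : VariableChange ℚ_[ℓ], Wd.baseChange ℚ_[ℓ] = D • W.baseChange ℚ_[ℓ] := by
  obtain ⟨θ, hθ⟩ := hsq
  have hθ0 : θ ≠ 0 := by
    rintro rfl
    exact (Rat.cast_ne_zero.mpr hd : ((d : ℚ) : ℚ_[ℓ]) ≠ 0) (hθ.trans (mul_zero 0))
  obtain ⟨C₁, hC₁⟩ := (W.baseChange ℚ_[ℓ]).exists_variableChange_smul_eq_quadraticTwist_sq hθ0
  have hθ' : algebraMap ℚ ℚ_[ℓ] d = θ ^ 2 := by rw [sq]; simpa using hθ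
  have h1 : (W.quadraticTwist d).baseChange ℚ_[ℓ] = C₁ • W.baseChange ℚ_[ℓ] := by
    rw [hC₁, baseChange, baseChange, map_quadraticTwist, hθ']
  refine ⟨C.map (algebraMap ℚ ℚ_[ℓ]) * C₁, ?_⟩
  rw [← hC, VariableChange.baseChange_smul_eq, h1, mul_smul]

/-- **Multiplicative reduction at `ℓ` transports along a twist by an `ℓ`-adic square**
(Silverman, *AEC* VII.5 Prop. 5.1(b), VII.1 Prop. 1.3(b): the chosen `ℤ_ℓ`-minimal models of
`W ⊗ ℚ_ℓ` and `Wd ⊗ ℚ_ℓ` are `ℚ_ℓ`-isomorphic minimal equations;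
`hasMultiplicativeReduction_iff_of_isMinimal_of_eq_smul`). [folklore] -/
theorem mult_iff_of_twist {d : ℚ} (hd : d ≠ 0) {ℓ : ℕ} [Fact ℓ.Prime]
    (hsq : IsSquare ((d : ℚ) : ℚ_[ℓ])) (Wd : WeierstrassCurve ℚ) [Wd.IsElliptic]
    {C : VariableChange ℚ} (hC : C • W.quadraticTwist d = Wd) :
    Mult Wd ℓ ↔ Mult W ℓ := by
  obtain ⟨D, hD⟩ := exists_baseChange_eq_smul_of_twist W hd hsq Wd hC
  unfold Mult HasMultiplicativeReductionAtPrime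
  haveI : (W.baseChange ℚ_[ℓ]).IsElliptic :=
    inferInstanceAs (W.map (algebraMap ℚ ℚ_[ℓ])).IsElliptic
  set X : WeierstrassCurve ℚ_[ℓ] := W.baseChange ℚ_[ℓ] with hX
  set Y : WeierstrassCurve ℚ_[ℓ] := Wd.baseChange ℚ_[ℓ] with hY
  set D₁ : VariableChange ℚ_[ℓ] := (X.exists_isMinimal ℤ_[ℓ]).choose with hD₁
  set D₂ : VariableChange ℚ_[ℓ] := (Y.exists_isMinimal ℤ_[ℓ]).choose with hD₂
  have h₁ : X.minimal ℤ_[ℓ] = D₁ • X := rfl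
  have h₂ : Y.minimal ℤ_[ℓ] = D₂ • Y := rfl
  have h : Y.minimal ℤ_[ℓ] = (D₂ * D * D₁⁻¹) • X.minimal ℤ_[ℓ] := by
    rw [h₂, hD, h₁, mul_smul, mul_smul, inv_smul_smul]
  have hΔ : (X.minimal ℤ_[ℓ]).Δ ≠ 0 := by
    rw [h₁, variableChange_Δ]
    exact mul_ne_zero (by simp) X.isUnit_Δ.ne_zero
  exact hasMultiplicativeReduction_iff_of_isMinimal_of_eq_smul ℤ_[ℓ] h hΔ

/-- **`v_ℓ(Δ_min)` transports along a twist by an `ℓ`-adic square**: for globally minimal `W`, `Wd`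
with `C • W^{(d)} = Wd` and `d ∈ (ℚ_ℓ^×)²`, `v_ℓ(Δ_min(Wd)) = v_ℓ(Δ_min(W))` — both equations are
`ℤ_ℓ`-minimal (`isMinimal_baseChange_padic_of_isGloballyMinimal`) and `ℚ_ℓ`-isomorphic, so their
discriminants have the same valuation (`padicMulValuation_Δ_smul_eq_of_isMinimal`; Silverman, *AEC*
VII.1 Prop. 1.3(b)), and `v_ℓ(Δ(W ⊗ ℚ_ℓ)) = v_ℓ(Δ_min)` (`padicValuation_Δ_baseChange_eq_padicValInt`).
In particular "`E[p]` ramified at the multiplicative `ℓ`" (`p ∤ v_ℓ(Δ_min)`) transports. [folklore] -/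
theorem padicValInt_minimalDiscriminantInt_eq_of_twist [W.IsGloballyMinimal] {d : ℚ} (hd : d ≠ 0)
    {ℓ : ℕ} [hℓ : Fact ℓ.Prime] (hsq : IsSquare ((d : ℚ) : ℚ_[ℓ])) (Wd : WeierstrassCurve ℚ)
    [Wd.IsElliptic] [Wd.IsGloballyMinimal] {C : VariableChange ℚ} (hC : C • W.quadraticTwist d = Wd) :
    padicValInt ℓ Wd.minimalDiscriminantInt = padicValInt ℓ W.minimalDiscriminantInt := by
  obtain ⟨D, hD⟩ := exists_baseChange_eq_smul_of_twist W hd hsq Wd hC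
  obtain ⟨v, hv⟩ : ∃ v : IsDedekindDomain.HeightOneSpectrum (𝓞 ℚ),
      ((Rat.HeightOneSpectrum.primesEquiv v : Nat.Primes) : ℕ) = ℓ :=
    ⟨Rat.HeightOneSpectrum.primesEquiv.symm ⟨ℓ, hℓ.out⟩, by rw [Equiv.apply_symm_apply]⟩
  subst hv
  have hX : (W.baseChange ℚ_[(Rat.HeightOneSpectrum.primesEquiv v : Nat.Primes)]).IsMinimal
      ℤ_[(Rat.HeightOneSpectrum.primesEquiv v : Nat.Primes)] :=
    isMinimal_baseChange_padic_of_isGloballyMinimal W v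
  have hY : (Wd.baseChange ℚ_[(Rat.HeightOneSpectrum.primesEquiv v : Nat.Primes)]).IsMinimal
      ℤ_[(Rat.HeightOneSpectrum.primesEquiv v : Nat.Primes)] :=
    isMinimal_baseChange_padic_of_isGloballyMinimal Wd v
  rw [hD] at hY
  have hmul := padicMulValuation_Δ_smul_eq_of_isMinimal _ D hX hY
  rw [← hD] at hmul
  haveI : (W.baseChange ℚ_[(Rat.HeightOneSpectrum.primesEquiv v : Nat.Primes)]).IsElliptic :=
    inferInstanceAs (W.map (algebraMap ℚ _)).IsElliptic
  haveI : (Wd.baseChange ℚ_[(Rat.HeightOneSpectrum.primesEquiv v : Nat.Primes)]).IsElliptic :=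
    inferInstanceAs (Wd.map (algebraMap ℚ _)).IsElliptic
  have h1 := (W.baseChange ℚ_[(Rat.HeightOneSpectrum.primesEquiv v : Nat.Primes)]).isUnit_Δ.ne_zero
  have h2 := (Wd.baseChange ℚ_[(Rat.HeightOneSpectrum.primesEquiv v : Nat.Primes)]).isUnit_Δ.ne_zero
  rw [padicMulValuation_apply_of_ne_zero h1, padicMulValuation_apply_of_ne_zero h2,
    WithZero.exp_inj, neg_inj] at hmul
  have e1 := padicValuation_Δ_baseChange_eq_padicValInt W
    ((Rat.HeightOneSpectrum.primesEquiv v : Nat.Primes) : ℕ)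
  have e2 := padicValuation_Δ_baseChange_eq_padicValInt Wd
    ((Rat.HeightOneSpectrum.primesEquiv v : Nat.Primes) : ℕ)
  have h : (padicValInt ((Rat.HeightOneSpectrum.primesEquiv v : Nat.Primes) : ℕ)
      Wd.minimalDiscriminantInt : ℤ) =
      padicValInt ((Rat.HeightOneSpectrum.primesEquiv v : Nat.Primes) : ℕ) W.minimalDiscriminantInt := by
    rw [← e1, ← e2]; exact hmul
  exact_mod_cast h

omit [W.IsElliptic] in
/-- **`E[p]` irreducible ⇒ `E^{(d)}[p]` irreducible** (`E^{(d)}[p] ≅ E[p] ⊗ χ_d`; Silverman, *AEC*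
X.5 Cor. 5.4): `W` is a model of the twist of `Wd` by `d` (`(C • W^{(d)})^{(d)} = C' • W^{(d²)} =
C'' • W`, by `quadraticTwist_smul`, `quadraticTwist_quadraticTwist`,
`exists_variableChange_smul_eq_quadraticTwist_sq`), so x1's `not_hasIrreducibleModPGaloisRep_twist`
applies in the reverse direction. [folklore] -/
theorem irr_of_twist [W.IsElliptic] {d : ℚ} (hd : d ≠ 0) (Wd : WeierstrassCurve ℚ) [Wd.IsElliptic]
    {C : VariableChange ℚ} (hC : C • W.quadraticTwist d = Wd) {p : ℕ} [Fact p.Prime]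
    (h : Irr W p) : Irr Wd p := by
  by_contra hred
  -- `W` is a model of the twist of `Wd` by `d`
  obtain ⟨C₀, hC₀⟩ := W.exists_variableChange_smul_eq_quadraticTwist_sq hd
  have hW : (⟨C.u, d * C.r, 0, 0⟩ * C₀ : VariableChange ℚ) • W = Wd.quadraticTwist d := by
    rw [mul_smul, hC₀, sq, ← quadraticTwist_quadraticTwist, ← quadraticTwist_smul, hC]
  exact not_hasIrreducibleModPGaloisRep_twist hred hd W _ hW h

/-- **The twist-transport link `hT` of `routeGoal_of_links`, PROVED**: for `W/ℚ` globally minimal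
elliptic, `K` imaginary quadratic and `Wd` a globally minimal model of `E^{(d_K)}`, at every prime
split in `K` multiplicative reduction and `v_ℓ(Δ_min)` transport from `W` to `Wd`, and
irreducibility of `E[p]` transports at every `p` (`TwistTransportAt W p K Wd`). These are the
hypotheses of Skinner 2016 Thm. C for `E^D` in Castella §5's last step. [folklore] -/
theorem twistTransportAt_of_twist [W.IsGloballyMinimal] (p : ℕ) [Fact p.Prime]
    (hK : IsImaginaryQuadratic K) (Wd : WeierstrassCurve ℚ) [Wd.IsElliptic] [Wd.IsGloballyMinimal]
    (hWd : ∃ C : VariableChange ℚ, C • W.quadraticTwist (NumberField.discr K : ℚ) = Wd) :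
    TwistTransportAt W p K Wd := by
  obtain ⟨C, hC⟩ := hWd
  have hd : (NumberField.discr K : ℚ) ≠ 0 := by exact_mod_cast NumberField.discr_ne_zero K
  refine ⟨fun hsp hm ↦ ?_, fun hirr ↦ irr_of_twist W hd Wd hC hirr, fun ℓ _ _ hsℓ hmℓ hvℓ ↦ ?_⟩
  · exact (mult_iff_of_twist W hd (isSquare_padic_discr_of_splitsIn hK.1 hsp) Wd hC).mpr hm
  · have hsq := isSquare_padic_discr_of_splitsIn hK.1 hsℓ
    exact ⟨(mult_iff_of_twist W hd hsq Wd hC).mpr hmℓ,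
      by rwa [padicValInt_minimalDiscriminantInt_eq_of_twist W hd hsq Wd hC]⟩

end Twist

/-- **Route R1 assembled, with the twist transport proved** (`routeGoal_of_links` of
`CastellaErratumChain.lean` with its hypothesis `hT` discharged by `twistTransportAt_of_twist`):
`RouteGoal` — `BSD(E,p)` for every rank-one pair on `ChainLocus` — from the PUBLISHED named facts
`hGZ` (Gross–Zagier 1986 Thm. I.7.3), `hGZK` (Gross–Zagier–Kolyvagin), `hSk` (Skinner 2016 Thm. C),
proved tree theorems, and FIVE `∀`-links: `hField` (PUB: Friedberg–Hoffstein 1995 Thm. B + sign),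
`hHeeg` (PUB: Gross 1984, YZZ 2013 / CST 2014), `hA` (OPEN ∘ PUB: display (5.3) ⇐ erratum Thm. 1.1
⇐ Fouquet–Wan Thm. 4.41), `hB` (PUB for semistable `E`; erratum's "same argument" otherwise), `hC`
(PUB, elementary). CONDITIONAL; deletes nothing. [cite: Castella2018, §5 (arXiv:1704.06608 p. 12)]
[cite: Castella2018Erratum, Thm. A′ (p. 1)] -/
theorem routeGoal_of_links'
    (hGZ : GrossZagier1986_thm_I_7_3) (hGZK : rank_eq_analyticRank_of_analyticRank_le_one)
    (hSk : Skinner2016.thmC_padicValRat_bsd_rank_zero)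
    (hField : ∀ (W : WeierstrassCurve ℚ) [W.IsElliptic] [W.IsGloballyMinimal] (p : ℕ) [Fact p.Prime]
        (q : ℕ) [Fact q.Prime], ErratumHypotheses W p → W.analyticRank = 1 → q ≠ p → Mult W q →
        ¬ W.HasSplitMultiplicativeReductionAtPrime q → ¬ p ∣ padicValInt q W.minimalDiscriminantInt →
        ∃ (K : Type) (_ : Field K) (_ : NumberField K), IsErratumField W K q)
    (hHeeg : ∀ (W : WeierstrassCurve ℚ) [W.IsElliptic] [W.IsGloballyMinimal] [NeZero (W.conductorNorm ℤ)]
        (p : ℕ) [Fact p.Prime] (q : ℕ) [Fact q.Prime] (K : Type) [Field K] [NumberField K],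
        ErratumHypotheses W p → W.analyticRank = 1 → Mult W q →
        ¬ W.HasSplitMultiplicativeReductionAtPrime q → IsErratumField W K q →
        ∃ P : (W.baseChange K).toAffine.Point,
          IsHeegnerPoint (W.conductorNorm ℤ) W K P ∧ ¬ IsOfFinAddOrder P)
    (hA : ∀ (W : WeierstrassCurve ℚ) [W.IsElliptic] [W.IsGloballyMinimal] [NeZero (W.conductorNorm ℤ)]
        (p : ℕ) [Fact p.Prime] (q : ℕ) [Fact q.Prime] (K : Type) [Field K] [NumberField K]
        (P : (W.baseChange K).toAffine.Point),
        ErratumHypotheses W p → W.analyticRank = 1 → q ≠ p → Mult W q →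
        ¬ W.HasSplitMultiplicativeReductionAtPrime q → ¬ p ∣ padicValInt q W.minimalDiscriminantInt →
        IsErratumField W K q → IsHeegnerPoint (W.conductorNorm ℤ) W K P → ¬ IsOfFinAddOrder P →
        Display53At W p K P)
    (hB : ∀ (W : WeierstrassCurve ℚ) [W.IsElliptic] [W.IsGloballyMinimal] [NeZero (W.conductorNorm ℤ)]
        (p : ℕ) [Fact p.Prime] (q : ℕ) [Fact q.Prime] (K : Type) [Field K] [NumberField K]
        (P : (W.baseChange K).toAffine.Point) (Wd : WeierstrassCurve ℚ) [Wd.IsElliptic]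
        [Wd.IsGloballyMinimal],
        ErratumHypotheses W p → W.analyticRank = 1 → Mult W q →
        ¬ W.HasSplitMultiplicativeReductionAtPrime q → IsErratumField W K q →
        IsHeegnerPoint (W.conductorNorm ℤ) W K P → ¬ IsOfFinAddOrder P →
        (∃ C : VariableChange ℚ, C • W.quadraticTwist (NumberField.discr K : ℚ) = Wd) →
        GZParaphraseAt W p K P Wd)
    (hC : ∀ (W : WeierstrassCurve ℚ) [W.IsElliptic] [W.IsGloballyMinimal] (p : ℕ) [Fact p.Prime]
        (q : ℕ) [Fact q.Prime] (K : Type) [Field K] [NumberField K] (Wd : WeierstrassCurve ℚ)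
        [Wd.IsElliptic] [Wd.IsGloballyMinimal],
        ErratumHypotheses W p → Mult W q → ¬ W.HasSplitMultiplicativeReductionAtPrime q →
        ¬ p ∣ padicValInt q W.minimalDiscriminantInt → IsErratumField W K q →
        (∃ C : VariableChange ℚ, C • W.quadraticTwist (NumberField.discr K : ℚ) = Wd) →
        TamagawaDescentAt W p K Wd) :
    RouteGoal :=
  routeGoal_of_links hGZ hGZK hSk hField hHeeg hA hB hC
    (fun W _ _ p _ _ _ _ Wd _ _ hK hWd ↦ twistTransportAt_of_twist W p hK Wd hWd)

end Summit.BirchSwinnertonDyer.Rank1Residual.X11b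

end
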